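import Literature.Geometry.Lorentzian.HawkingCrushBoundProofs
import Literature.Geometry.Lorentzian.HawkingSingularityPrelim
import Literature.Geometry.Lorentzian.RadialCausalCone
import Literature.Geometry.Lorentzian.HypersurfaceRestriction
import Literature.Geometry.Riemannian.EndmanifoldVariation
import Literature.Geometry.Riemannian.VariationEnergyTaylor
import Literature.Geometry.Riemannian.ExpMapCovDerivLift
import Literature.Geometry.Riemannian.JacobiVariation
import Literature.Geometry.Riemannian.ParallelTransportSmooth
import HarnessLib

/-!
# Hawking's crush bound: the second variation along a maximising normal geodesic

The SECOND-VARIATION HALF `hvar` of `HawkingCrushBound_of_maximiser_of_secondVariation`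
(`HawkingCrushBoundProofs.lean`; O'Neill 1983, Ch. 10, Prop. 37 and Ch. 14, Thm. 55A; Wald 1984,
Prop. 9.3.4 with Thm. 9.5.1), PROVED:

* `secondVariation_nonneg_of_maximal` — for a unit-speed normal geodesic
  `γ(t) = exp_{f y₀}(t ν(y₀))`, `t ∈ [0, L₀]`, of a spacelike hypersurface `f : N → M` with future
  unit normal `ν`, which is length-maximising among the future causal curves from `f(N)` to
  `γ(L₀)`, and every field `V` along `γ` (smooth near `[0, L₀]`) with `V(L₀) = 0`,
  `V(0) = df(w₀)` and `g(V', γ') = 0`: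
  `0 ≤ K_ν(w₀, w₀) + ∫₀ᴸ⁰ (g(R(V, γ')V, γ') + g(V', V')) dt`.
  This is "`L''(0) ≤ 0` for every `(P, q)`-variation of a maximising geodesic" with O'Neill's
  second variation formula (Ch. 10, Thm. 4 and Cor. 26, p. 283: the endmanifold term
  `-⟨σ'(0), II(V(0), V(0))⟩`), obtained here WITHOUT the formula for `L''` as such: the
  endmanifold variation `x` of `γ` with variation field `V` (`exists_endmanifold_variation`,
  O'Neill's Lemma 10.49) has future timelike longitudinal curves from `f(N)` to `γ(L₀)` for small
  `σ`, of length `≤ L₀` by maximality, while `-g(∂_t x, ∂_t x) ≥ 1 - σ²(h + ε)` to second order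
  (`val_velocity_le_taylor`, O'Neill's Lemma 10.38, the first-order term `2σ g(V', γ')` vanishing);
  the limiting argument `integral_nonneg_of_sqrt_integral_le` gives `∫₀ᴸ⁰ h ≥ 0`, and
  `∫ h = K_ν(w₀, w₀) + ∫ (g(R(V,γ')V,γ') + |V'|²)` by the fundamental theorem of calculus for the
  acceleration term `g(D_t A, γ') = (g(A, γ'))'` (`A = D_σ ∂_σ x`, `A(L₀) = 0`,
  `g(A(0), ν) = -K_ν(w₀, w₀)` since the first transverse curve lies in the hypersurface,
  `covariantDerivAlong_comp_eq_normalDerivAlong`).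
* `length_le_of_maximal_normalGeodesic` — **the second-variation half**: under the
  timelike convergence condition, if such a maximising normal geodesic issues from a point with
  mean curvature `H(y₀) ≤ -C < 0` then `L₀ ≤ 3/C` (O'Neill's Prop. 10.37 computation with
  `Vᵢ = (1 - t/L₀)Eᵢ` for a parallel orthonormal frame `Eᵢ ⊥ γ'`: `∑ᵢ K(wᵢ, wᵢ) = H(y₀)`,
  `∑ᵢ g(R(Eᵢ,γ')Eᵢ,γ') = -Ric(γ',γ') ≤ 0`, `∑ᵢ |Vᵢ'|² = 3/L₀²`).

No definitions and no named facts are introduced (D-0026).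

## References

* B. O'Neill, *Semi-Riemannian geometry with applications to relativity*, Academic Press 1983,
  Ch. 10, Thm. 4, Cor. 26, Prop. 37, Lemma 38, Lemma 49; Ch. 14, Thm. 55A.
  [ONeillSemiRiemannian1983]
* R. M. Wald, *General Relativity*, Chicago 1984, Prop. 9.3.4, Thm. 9.5.1. [Wald1984GR]
-/

noncomputable section

open Bundle Set Filter Function Manifold MeasureTheory
open scoped Manifold ContDiff Topology ENNReal

universe u

namespace Literature.Geometry.Lorentzian

open Literature.Geometry.Riemannian PseudoRiemannianMetric

set_option maxHeartbeats 800000 in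
/-- **`L''(0) ≤ 0` along a maximising normal geodesic, in integrated form** (O'Neill 1983,
Ch. 10, Thm. 4 with Cor. 26 and the proof of Prop. 37; Wald 1984, Prop. 9.3.4). In a
four-dimensional spacetime let `f : N → M` be a smooth spacelike immersion of a `3`-manifold with
smooth future unit normal field `ν`, and let the normal geodesic `γ(t) = exp_{f y₀}(t ν(y₀))` be
defined on `(a, b) ⊇ [0, L₀]`, `L₀ > 0`, and length-maximising: every future causal curve from a
point of `f(N)` to `γ(L₀)` has length `≤ L₀`. Then for every field `V` along `γ` with `C^∞` lift on
`(a, b)`, `V(L₀) = 0`, `V(0) = df_{y₀}(w₀)` and `g(V', γ') = 0` on `[0, L₀]`, the functions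
`ρ = g(R(V, γ')V, γ')` and `κ = g(V', V')` (taken as arguments, with their defining equations on
`[0, L₀]` as hypotheses, to keep the statement small) are continuous on `[0, L₀]` and
`0 ≤ K_ν(w₀, w₀) + ∫₀ᴸ⁰ (ρ + κ) dt`.
[cite: ONeillSemiRiemannian1983, Ch. 10, Thm. 4, Cor. 26 and Prop. 37]
[cite: Wald1984GR, Prop. 9.3.4] -/
theorem secondVariation_nonneg_of_maximal (𝓢 : Spacetime.{u} 4)
    [𝓢.metric.HasLeviCivita]
    {N : Type u} [TopologicalSpace N] [ChartedSpace E3 N] [IsManifold (𝓡 3) ∞ N]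
    {f : N → 𝓢.carrier} (hf : 𝓢.metric.IsSpacelikeImmersion (𝓡 3) f) {ν : NormalField (𝓡 4) f}
    (hν : ContMDiff (𝓡 3) (𝓡 4).tangent ∞
      (fun y ↦ (TotalSpace.mk' E4 (f y) (ν y) : TangentBundle (𝓡 4) 𝓢.carrier)))
    (hfun : 𝓢.metric.IsFutureUnitNormal (𝓡 3) 𝓢.timeOrientation f ν)
    {y₀ : N} {L₀ a b : ℝ} (ha : a < 0) (hL₀ : 0 < L₀) (hb : L₀ < b)
    (hdom : Ioo a b ⊆ maximalGeodesicDomain 𝓢.metric.leviCivita (f y₀) (ν y₀))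
    (hmax : ∀ (y' : N) (γ : ℝ → 𝓢.carrier) (a b : ℝ), a < b →
      𝓢.metric.IsFutureCausalCurveOn 𝓢.timeOrientation γ (Icc a b) → γ a = f y' →
      γ b = expMap 𝓢.metric.leviCivita (f y₀) (L₀ • ν y₀) →
      𝓢.metric.arcLength γ a b ≤ ENNReal.ofReal L₀)
    {V : Π t : ℝ, TangentSpace (𝓡 4) (expMap 𝓢.metric.leviCivita (f y₀) (t • ν y₀))}
    (hV : ∀ t ∈ Ioo a b, ContMDiffAt 𝓘(ℝ, ℝ) (𝓡 4).tangent ∞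
      (fun t ↦ (TotalSpace.mk' E4 (expMap 𝓢.metric.leviCivita (f y₀) (t • ν y₀)) (V t) :
        TangentBundle (𝓡 4) 𝓢.carrier)) t)
    (hVL : V L₀ = 0) {w₀ : TangentSpace (𝓡 3) y₀} (hV0 : V 0 = mfderiv (𝓡 3) (𝓡 4) f y₀ w₀)
    (hVperp : ∀ t ∈ Icc 0 L₀, 𝓢.metric.val (expMap 𝓢.metric.leviCivita (f y₀) (t • ν y₀))
      (covariantDerivAlong 𝓢.metric.leviCivita
        (fun t ↦ expMap 𝓢.metric.leviCivita (f y₀) (t • ν y₀)) V t)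
      (velocity (𝓡 4) (fun t ↦ expMap 𝓢.metric.leviCivita (f y₀) (t • ν y₀)) t) = 0)
    {ρ κ : ℝ → ℝ}
    (hρ : ∀ t ∈ Icc 0 L₀, ρ t = 𝓢.metric.val (expMap 𝓢.metric.leviCivita (f y₀) (t • ν y₀))
      (𝓢.metric.leviCivita.curvature (expMap 𝓢.metric.leviCivita (f y₀) (t • ν y₀)) (V t)
        (velocity (𝓡 4) (fun t ↦ expMap 𝓢.metric.leviCivita (f y₀) (t • ν y₀)) t) (V t))
      (velocity (𝓡 4) (fun t ↦ expMap 𝓢.metric.leviCivita (f y₀) (t • ν y₀)) t))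
    (hκ : ∀ t ∈ Icc 0 L₀, κ t = 𝓢.metric.val (expMap 𝓢.metric.leviCivita (f y₀) (t • ν y₀))
      (covariantDerivAlong 𝓢.metric.leviCivita
        (fun t ↦ expMap 𝓢.metric.leviCivita (f y₀) (t • ν y₀)) V t)
      (covariantDerivAlong 𝓢.metric.leviCivita
        (fun t ↦ expMap 𝓢.metric.leviCivita (f y₀) (t • ν y₀)) V t)) :
    ContinuousOn ρ (Icc 0 L₀) ∧ ContinuousOn κ (Icc 0 L₀) ∧
      0 ≤ 𝓢.metric.secondFundamentalForm (𝓡 3) f ν y₀ w₀ w₀ + ∫ t in (0 : ℝ)..L₀, (ρ t + κ t) := by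
  classical
  /- 0. Notation and regularity. -/
  let γ : ℝ → 𝓢.carrier := fun t ↦ expMap 𝓢.metric.leviCivita (f y₀) (t • ν y₀)
  let M := 𝓢.carrier
  let g := 𝓢.metric
  let τ := 𝓢.timeOrientation
  let cov := 𝓢.metric.leviCivita
  have hk1 : (((1 : ℕ∞) : ℕ∞ω)) + 1 ≤ ((⊤ : ℕ∞) : ℕ∞ω) := by exact_mod_cast le_top
  have hkT : (((⊤ : ℕ∞) : ℕ∞ω)) + 1 ≤ ((⊤ : ℕ∞) : ℕ∞ω) := by exact_mod_cast le_top
  have hreg₁ : cov.IsLocallyContMDiff 1 := 𝓢.metric.isLocallyContMDiff_leviCivita_holds 1 hk1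
  have hreg : cov.IsLocallyContMDiff ∞ := 𝓢.metric.isLocallyContMDiff_leviCivita_holds ⊤ hkT
  haveI : CovariantDerivative.ContMDiffCovariantDerivative cov 1 := ⟨hreg₁ univ isOpen_univ⟩
  haveI : CovariantDerivative.ContMDiffCovariantDerivative cov (⊤ : ℕ∞) :=
    ⟨hreg univ isOpen_univ⟩
  have hn : ((⊤ : ℕ∞) : ℕ∞ω) ≤ ((⊤ : ℕ∞) : ℕ∞ω) := le_rfl
  have hTne : ((⊤ : ℕ∞) : ℕ∞ω) ≠ 0 := by simp
  have hLC : g.IsLeviCivita cov := isLeviCivita_leviCivita_holds (g := g.toPseudoRiemannianMetric)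
  /- 1. The normal geodesic. -/
  obtain ⟨hmaxg, h0D, -, -⟩ := maximalGeodesic_spec' (cov := cov) (f y₀) (ν y₀)
  let D := maximalGeodesicDomain cov (f y₀) (ν y₀)
  have hD : D = maximalGeodesicDomain cov (f y₀) (ν y₀) := rfl
  have hDo : IsOpen D := hmaxg.isOpen
  have hgeo : IsGeodesicOn cov γ D := isGeodesicOn_expMap_smul (cov := cov) (f y₀) (ν y₀)
  have hv0 : velocity (𝓡 4) γ 0 = ν y₀ := velocity_expMap_smul_zero (cov := cov) (f y₀) (ν y₀)
  have hγ0 : γ 0 = f y₀ := by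
    show expMap cov (f y₀) ((0 : ℝ) • ν y₀) = f y₀
    rw [zero_smul]
    exact expMap_zero (cov := cov) (f y₀)
  have hνν : g.val (f y₀) (ν y₀) (ν y₀) = -1 := hfun.1.2 y₀
  have hνt : g.IsTimelike (ν y₀) := by
    show g.val (f y₀) (ν y₀) (ν y₀) < 0
    rw [hνν]
    norm_num
  have hunit : ∀ t ∈ D, g.val (γ t) (velocity (𝓡 4) γ t) (velocity (𝓡 4) γ t) = -1 := by
    intro t ht
    have h := g.toPseudoRiemannianMetric.val_velocity_eq_of_isGeodesicOn_holds hDo hmaxg.2.1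
      hgeo ht h0D
    rw [hv0, hγ0] at h
    exact h.trans hνν
  have hfd : ∀ t ∈ D, g.IsTimelike (velocity (𝓡 4) γ t) ∧ τ.IsFutureDirected (velocity (𝓡 4) γ t) :=
    fun t ht ↦ isTimelike_isFutureDirected_velocity_expMap_smul τ hνt (hfun.2 y₀) ht
  have hIccD : Icc 0 L₀ ⊆ D := fun t ht ↦ hdom ⟨ha.trans_le ht.1, ht.2.trans_lt hb⟩
  /- 2. The endmanifold variation. -/
  have hι : Injective (mfderiv (𝓡 3) (𝓡 4) f y₀) := hf.injective_mfderiv y₀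
  have hνz : ν y₀ ∉ range (mfderiv (𝓡 3) (𝓡 4) f y₀) := by
    rintro ⟨v, hv⟩
    have h1 : g.val (f y₀) (ν y₀) (mfderiv (𝓡 3) (𝓡 4) f y₀ v) = 0 := hfun.1.1 y₀ v
    rw [hv, hνν] at h1
    norm_num at h1
  have hdim : Module.finrank ℝ E3 + 1 = Module.finrank ℝ E4 := by simp
  obtain ⟨x, ζ, hxs, hζs, hζ0, hζv, hx0, hxL, hxγ, hxV⟩ :=
    exists_endmanifold_variation (I := 𝓡 4) (I' := 𝓡 3) (ι := f) (ν := ν) (cov := cov) hν hι hνz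
      hdim ha hL₀ hb hdom hV hVL hV0
  /- 3. The fields `T = ∂_t x`, `S = ∂_σ x`, `D_t S`, `A = D_σ S`, `D_t A` and their smooth
  lifts. -/
  have hT : ContMDiff (𝓘(ℝ, ℝ).prod 𝓘(ℝ, ℝ)) (𝓡 4).tangent ∞ (fun q : ℝ × ℝ ↦
      (TotalSpace.mk' E4 (x q.1 q.2) (velocity (𝓡 4) (fun t' ↦ x t' q.2) q.1) :
        TangentBundle (𝓡 4) M)) :=
    contMDiff_lift_velocity_uncurry_left hxs
  have hswap : ContMDiff (𝓘(ℝ, ℝ).prod 𝓘(ℝ, ℝ)) (𝓘(ℝ, ℝ).prod 𝓘(ℝ, ℝ)) ∞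
      (fun q : ℝ × ℝ ↦ ((q.2, q.1) : ℝ × ℝ)) := contMDiff_snd.prodMk contMDiff_fst
  have hS : ContMDiff (𝓘(ℝ, ℝ).prod 𝓘(ℝ, ℝ)) (𝓡 4).tangent ∞ (fun q : ℝ × ℝ ↦
      (TotalSpace.mk' E4 (x q.1 q.2) (velocity (𝓡 4) (x q.1) q.2) : TangentBundle (𝓡 4) M)) := by
    have hx' : ContMDiff (𝓘(ℝ, ℝ).prod 𝓘(ℝ, ℝ)) (𝓡 4) ∞ (uncurry fun s t ↦ x t s) :=
      hxs.comp hswap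
    exact (contMDiff_lift_velocity_uncurry_left hx').comp hswap
  have hDtS : ContMDiff (𝓘(ℝ, ℝ).prod 𝓘(ℝ, ℝ)) (𝓡 4).tangent ∞ (fun q : ℝ × ℝ ↦
      (TotalSpace.mk' E4 (x q.1 q.2) (covariantDerivAlong cov (fun t' ↦ x t' q.2)
        (fun t' ↦ velocity (𝓡 4) (x t') q.2) q.1) : TangentBundle (𝓡 4) M)) :=
    contMDiff_lift_covariantDerivAlong_curry_left (cov := cov) hreg (x := x)
      (Z := fun t s ↦ velocity (𝓡 4) (x t) s) hxs hS
  have hA : ContMDiff (𝓘(ℝ, ℝ).prod 𝓘(ℝ, ℝ)) (𝓡 4).tangent ∞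
      (fun q : ℝ × ℝ ↦ (TotalSpace.mk' E4 (x q.1 q.2)
        (covariantDerivAlong cov (x q.1) (fun s' ↦ velocity (𝓡 4) (x q.1) s') q.2) :
          TangentBundle (𝓡 4) M)) :=
    contMDiff_lift_covariantDerivAlong_curry_right (cov := cov) hreg (x := x)
      (Z := fun t s ↦ velocity (𝓡 4) (x t) s) hxs hS
  have hDtA : ContMDiff (𝓘(ℝ, ℝ).prod 𝓘(ℝ, ℝ)) (𝓡 4).tangent ∞
      (fun q : ℝ × ℝ ↦ (TotalSpace.mk' E4 (x q.1 q.2)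
        (covariantDerivAlong cov (fun t' ↦ x t' q.2)
          (fun t' ↦ covariantDerivAlong cov (x t') (fun s' ↦ velocity (𝓡 4) (x t') s') q.2) q.1) :
          TangentBundle (𝓡 4) M)) :=
    contMDiff_lift_covariantDerivAlong_curry_left (cov := cov) hreg (x := x)
      (Z := fun t s ↦ covariantDerivAlong cov (x t) (fun s' ↦ velocity (𝓡 4) (x t) s') s) hxs hA
  have hτx : ContMDiff (𝓘(ℝ, ℝ).prod 𝓘(ℝ, ℝ)) (𝓡 4).tangent ∞ (fun q : ℝ × ℝ ↦
      (TotalSpace.mk' E4 (x q.1 q.2) (τ.vectorField (x q.1 q.2)) : TangentBundle (𝓡 4) M)) :=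
    τ.contMDiff.comp hxs
  /- 4. The scalar functions. -/
  let fTT : ℝ × ℝ → ℝ := fun q ↦ g.val (x q.1 q.2) (velocity (𝓡 4) (fun t' ↦ x t' q.2) q.1)
    (velocity (𝓡 4) (fun t' ↦ x t' q.2) q.1)
  have hfTT : fTT = fun q ↦ g.val (x q.1 q.2) (velocity (𝓡 4) (fun t' ↦ x t' q.2) q.1)
    (velocity (𝓡 4) (fun t' ↦ x t' q.2) q.1) := rfl
  let fτT : ℝ × ℝ → ℝ := fun q ↦ g.val (x q.1 q.2) (τ.vectorField (x q.1 q.2))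
    (velocity (𝓡 4) (fun t' ↦ x t' q.2) q.1)
  have hfτT : fτT = fun q ↦ g.val (x q.1 q.2) (τ.vectorField (x q.1 q.2))
    (velocity (𝓡 4) (fun t' ↦ x t' q.2) q.1) := rfl
  let hacc : ℝ × ℝ → ℝ := fun q ↦ g.val (x q.1 q.2)
    (covariantDerivAlong cov (fun t' ↦ x t' q.2)
      (fun t' ↦ covariantDerivAlong cov (x t') (fun s' ↦ velocity (𝓡 4) (x t') s') q.2) q.1)
    (velocity (𝓡 4) (fun t' ↦ x t' q.2) q.1)
  let hcurv : ℝ × ℝ → ℝ := fun q ↦ g.val (x q.1 q.2)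
    (cov.curvature (x q.1 q.2) (velocity (𝓡 4) (x q.1) q.2)
      (velocity (𝓡 4) (fun t' ↦ x t' q.2) q.1) (velocity (𝓡 4) (x q.1) q.2))
    (velocity (𝓡 4) (fun t' ↦ x t' q.2) q.1)
  have hhcurv : hcurv = fun q ↦ g.val (x q.1 q.2)
    (cov.curvature (x q.1 q.2) (velocity (𝓡 4) (x q.1) q.2)
      (velocity (𝓡 4) (fun t' ↦ x t' q.2) q.1) (velocity (𝓡 4) (x q.1) q.2))
    (velocity (𝓡 4) (fun t' ↦ x t' q.2) q.1) := rfl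
  let hvel : ℝ × ℝ → ℝ := fun q ↦ g.val (x q.1 q.2)
    (covariantDerivAlong cov (fun t' ↦ x t' q.2) (fun t' ↦ velocity (𝓡 4) (x t') q.2) q.1)
    (covariantDerivAlong cov (fun t' ↦ x t' q.2) (fun t' ↦ velocity (𝓡 4) (x t') q.2) q.1)
   
  have hhvel : hvel = fun q ↦ g.val (x q.1 q.2)
    (covariantDerivAlong cov (fun t' ↦ x t' q.2) (fun t' ↦ velocity (𝓡 4) (x t') q.2) q.1)
    (covariantDerivAlong cov (fun t' ↦ x t' q.2) (fun t' ↦ velocity (𝓡 4) (x t') q.2) q.1)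
    := rfl
  let hh : ℝ × ℝ → ℝ := fun q ↦ hacc q + hcurv q + hvel q
  have hhh : hh = fun q ↦ hacc q + hcurv q + hvel q := rfl
  have hfTTs : ContMDiff (𝓘(ℝ, ℝ).prod 𝓘(ℝ, ℝ)) 𝓘(ℝ, ℝ) ∞ fTT := fun q ↦
    contMDiffAt_val_apply_along g.toPseudoRiemannianMetric hn (hT q) (hT q)
  have hfτTs : ContMDiff (𝓘(ℝ, ℝ).prod 𝓘(ℝ, ℝ)) 𝓘(ℝ, ℝ) ∞ fτT := fun q ↦
    contMDiffAt_val_apply_along g.toPseudoRiemannianMetric hn (hτx q) (hT q)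
  have haccs : ContMDiff (𝓘(ℝ, ℝ).prod 𝓘(ℝ, ℝ)) 𝓘(ℝ, ℝ) ∞ hacc := fun q ↦
    contMDiffAt_val_apply_along g.toPseudoRiemannianMetric hn (hDtA q) (hT q)
  have hvels : ContMDiff (𝓘(ℝ, ℝ).prod 𝓘(ℝ, ℝ)) 𝓘(ℝ, ℝ) ∞ hvel := fun q ↦
    contMDiffAt_val_apply_along g.toPseudoRiemannianMetric hn (hDtS q) (hDtS q)
  -- continuity of the full second-order coefficient (O'Neill's Lemma 10.38)
  obtain ⟨hhc, htaylor⟩ := val_velocity_le_taylor g.toPseudoRiemannianMetric hn hxs 0 L₀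
  have hhc' : Continuous hh := hhc
  have hcurvc : Continuous hcurv := by
    have : hcurv = fun q ↦ hh q - hacc q - hvel q := by
      funext q
      simp only [hhh]
      ring
    rw [this]
    exact (hhc'.sub haccs.continuous).sub hvels.continuous
  /- 5. Identification along `σ = 0`. -/
  obtain ⟨O', hO'o, hO'sub, hO'p⟩ := eventually_nhdsSet_iff_exists.1 (hxγ.and hxV)
  let O : Set ℝ := O' ∩ Ioo a b
  have hO : O = O' ∩ Ioo a b := rfl
  have hOo : IsOpen O := hO'o.inter isOpen_Ioo
  have hOsub : Icc 0 L₀ ⊆ O := subset_inter hO'sub (Icc_subset_Ioo ha hb)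
  have hOp : ∀ t ∈ O, x t 0 = γ t ∧ velocity (𝓡 4) (x t) 0 = V t := fun t ht ↦ hO'p t ht.1
  have hOD : O ⊆ D := fun t ht ↦ hdom ht.2
  have hc₀ : ∀ t ∈ O, (fun t' ↦ x t' 0) =ᶠ[𝓝 t] γ := fun t ht ↦
    Filter.eventually_of_mem (hOo.mem_nhds ht) fun t' ht' ↦ (hOp t' ht').1
  have hT0 : ∀ t ∈ O, velocity (𝓡 4) (fun t' ↦ x t' 0) t = velocity (𝓡 4) γ t := fun t ht ↦
    velocity_congr_of_eventuallyEq (I := 𝓡 4) (hc₀ t ht)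
  have hS0 : ∀ t ∈ O, velocity (𝓡 4) (x t) 0 = V t := fun t ht ↦ (hOp t ht).2
  have hlift0 : ∀ t ∈ O, (fun t' ↦ (TotalSpace.mk' E4 (x t' 0) (velocity (𝓡 4) (x t') 0) :
      TangentBundle (𝓡 4) M)) =ᶠ[𝓝 t]
      fun t' ↦ (TotalSpace.mk' E4 (γ t') (V t') : TangentBundle (𝓡 4) M) := by
    intro t ht
    filter_upwards [hOo.mem_nhds ht] with t' ht'
    obtain ⟨h1, h2⟩ := hOp t' ht'
    show TotalSpace.mk' E4 (x t' 0) (velocity (𝓡 4) (x t') 0) = TotalSpace.mk' E4 (γ t') (V t')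
    rw [h2, h1]
  have hDtS0 : ∀ t ∈ O, covariantDerivAlong cov (fun t' ↦ x t' 0)
      (fun t' ↦ velocity (𝓡 4) (x t') 0) t = covariantDerivAlong cov γ V t := fun t ht ↦
    covariantDerivAlong_congr_of_eventuallyEq cov (hlift0 t ht)
  have hTT0 : ∀ t ∈ O, fTT (t, 0) = -1 := by
    intro t ht
    simp only [hfTT, hT0 t ht]
    rw [(hOp t ht).1]
    exact hunit t (hOD ht)
  have h0O : (0 : ℝ) ∈ O := hOsub ⟨le_rfl, hL₀.le⟩
  /- 6. The Taylor bound: `-g(T,T)(t, σ) ≥ 1 - σ²(h(t, 0) + ε)`. -/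
  have htaylor' : ∀ ε > 0, ∃ δ > 0, ∀ σ ∈ Icc (0 : ℝ) δ, ∀ t ∈ Icc 0 L₀,
      1 - σ ^ 2 * (hh (t, 0) + ε) ≤ -fTT (t, σ) := by
    intro ε hε
    obtain ⟨δ, hδ, hδp⟩ := htaylor ε hε
    refine ⟨δ, hδ, fun σ hσ t ht ↦ ?_⟩
    have hO := hOsub ht
    have hk : g.val (x t 0)
        (covariantDerivAlong cov (fun t' ↦ x t' 0) (fun t' ↦ velocity (𝓡 4) (x t') 0) t)
        (velocity (𝓡 4) (fun t' ↦ x t' 0) t) = 0 := by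
      rw [hDtS0 t hO, hT0 t hO, (hOp t hO).1]
      exact hVperp t ht
    have h1 : fTT (t, σ) ≤ fTT (t, 0) + σ * (2 * g.val (x t 0)
        (covariantDerivAlong cov (fun t' ↦ x t' 0) (fun t' ↦ velocity (𝓡 4) (x t') 0) t)
        (velocity (𝓡 4) (fun t' ↦ x t' 0) t)) + σ * σ * (hh (t, 0) + ε) := hδp σ hσ t ht
    rw [hk, hTT0 t hO] at h1
    have hsq : σ ^ 2 = σ * σ := sq σ
    rw [hsq]
    linarith
  /- 7. The longitudinal curves near `σ = 0` are future timelike. -/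
  have hneg0 : ∀ t ∈ Icc 0 L₀, fTT (t, 0) < 0 ∧ fτT (t, 0) < 0 := by
    intro t ht
    have hO := hOsub ht
    refine ⟨by rw [hTT0 t hO]; norm_num, ?_⟩
    simp only [hfτT, hT0 t hO]
    rw [(hOp t hO).1]
    exact (hfd t (hIccD ht)).2.2
  let W : Set (ℝ × ℝ) := {q | fTT q < 0 ∧ fτT q < 0}
  have hWo : IsOpen W :=
    (isOpen_lt hfTTs.continuous continuous_const).inter
      (isOpen_lt hfτTs.continuous continuous_const)
  have hKW : Icc 0 L₀ ×ˢ ({0} : Set ℝ) ⊆ W := by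
    rintro ⟨t, σ⟩ ⟨ht, hσ⟩
    rw [mem_singleton_iff] at hσ
    subst hσ
    exact hneg0 t ht
  obtain ⟨A₁, B₁, -, hB₁o, hA₁, hB₁, hAB₁⟩ :=
    generalized_tube_lemma isCompact_Icc isCompact_singleton hWo hKW
  obtain ⟨δ₁, hδ₁, hδ₁sub⟩ : ∃ δ₁ > 0, Icc (0 : ℝ) δ₁ ⊆ B₁ := by
    obtain ⟨ε, hε, hεsub⟩ := Metric.isOpen_iff.1 hB₁o 0 (hB₁ rfl)
    refine ⟨ε / 2, by positivity, fun σ hσ ↦ hεsub ?_⟩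
    rw [Metric.mem_ball, Real.dist_eq, sub_zero, abs_lt]
    constructor <;> linarith [hσ.1, hσ.2]
  have htube : ∀ σ ∈ Icc (0 : ℝ) δ₁, ∀ t ∈ Icc 0 L₀, fTT (t, σ) < 0 ∧ fτT (t, σ) < 0 :=
    fun σ hσ t ht ↦ hAB₁ (mk_mem_prod (hA₁ ht) (hδ₁sub hσ))
  /- 8. Maximality: `∫₀ᴸ⁰ √(-g(T,T)(t, σ)) dt ≤ L₀` for `σ ∈ (0, δ₁]`. -/
  have hcurve : ∀ σ ∈ Icc (0 : ℝ) δ₁, g.IsFutureCausalCurveOn τ (fun t ↦ x t σ) (Icc 0 L₀) := by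
    intro σ hσ t ht
    refine ⟨((hxs.comp (contMDiff_id.prodMk contMDiff_const)) t).mdifferentiableAt hTne, ?_⟩
    obtain ⟨h1, h2⟩ := htube σ hσ t ht
    have h1' : g.IsTimelike (velocity (𝓡 4) (fun t' ↦ x t' σ) t) := h1
    exact ⟨h1'.isCausal, h2⟩
  have hlen : ∀ σ ∈ Ioc (0 : ℝ) δ₁, (∫ t in (0 : ℝ)..L₀, Real.sqrt (-fTT (t, σ))) ≤ L₀ := by
    intro σ hσ
    have hσ' : σ ∈ Icc (0 : ℝ) δ₁ := ⟨hσ.1.le, hσ.2⟩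
    have h1 := hmax (ζ σ) (fun t ↦ x t σ) 0 L₀ hL₀ (hcurve σ hσ') (hx0 σ) (hxL σ)
    have hspeed : ∀ t ∈ Icc 0 L₀, g.toPseudoRiemannianMetric.speed (fun t' ↦ x t' σ) t =
        Real.sqrt (-fTT (t, σ)) := fun t ht ↦
      speed_eq_sqrt_neg_of_nonpos (le_of_lt (htube σ hσ' t ht).1)
    have hcont : Continuous (fun t ↦ Real.sqrt (-fTT (t, σ))) :=
      Real.continuous_sqrt.comp
        ((hfTTs.continuous.comp (continuous_id.prodMk continuous_const)).neg)
    have harc : g.arcLength (fun t' ↦ x t' σ) 0 L₀ =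
        ENNReal.ofReal (∫ t in (0 : ℝ)..L₀, Real.sqrt (-fTT (t, σ))) := by
      rw [arcLength_eq_lintegral_Icc, intervalIntegral.integral_of_le hL₀.le,
        ← integral_Icc_eq_integral_Ioc, ofReal_integral_eq_lintegral_ofReal]
      · exact setLIntegral_congr_fun measurableSet_Icc fun t ht ↦ by rw [hspeed t ht]
      · exact hcont.integrableOn_Icc
      · exact Eventually.of_forall fun t ↦ Real.sqrt_nonneg _
    rw [harc] at h1
    exact (ENNReal.ofReal_le_ofReal_iff hL₀.le).1 h1
  /- 9. The limiting argument: `∫₀ᴸ⁰ h(t, 0) dt ≥ 0`. -/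
  have hint : 0 ≤ ∫ t in (0 : ℝ)..L₀, hh (t, 0) :=
    integral_nonneg_of_sqrt_integral_le hL₀ (h := fun t ↦ hh (t, 0))
      (N := fun t σ ↦ -fTT (t, σ))
      (hhc'.comp (continuous_id.prodMk continuous_const)).continuousOn
      (fun σ ↦ ((hfTTs.continuous.comp (continuous_id.prodMk continuous_const)).neg).continuousOn)
      (fun ε hε ↦ by
        obtain ⟨δ, hδ, hδp⟩ := htaylor' ε hε
        exact ⟨min δ δ₁, lt_min hδ hδ₁, fun σ hσ ↦
          ⟨hlen σ ⟨hσ.1, hσ.2.trans (min_le_right _ _)⟩,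
            fun t ht ↦ hδp σ ⟨hσ.1.le, hσ.2.trans (min_le_left _ _)⟩ t ht⟩⟩)
  /- 10. The acceleration term integrates to the endmanifold term. -/
  let c₀ : ℝ → M := fun t ↦ x t 0
  let Af : Π t : ℝ, TangentSpace (𝓡 4) (c₀ t) := fun t ↦
    covariantDerivAlong cov (x t) (fun s' ↦ velocity (𝓡 4) (x t) s') 0
  let Tf : Π t : ℝ, TangentSpace (𝓡 4) (c₀ t) := fun t ↦ velocity (𝓡 4) c₀ t
  have hline0 : ContMDiff 𝓘(ℝ, ℝ) (𝓘(ℝ, ℝ).prod 𝓘(ℝ, ℝ)) ∞ (fun t : ℝ ↦ ((t, (0 : ℝ)) : ℝ × ℝ)) :=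
    contMDiff_id.prodMk contMDiff_const
  have hAfd : ∀ t, MDifferentiableAt 𝓘(ℝ, ℝ) (𝓡 4).tangent
      (fun t ↦ (TotalSpace.mk' E4 (c₀ t) (Af t) : TangentBundle (𝓡 4) M)) t := fun t ↦
    ((hA.comp hline0) t).mdifferentiableAt hTne
  have hTfd : ∀ t, MDifferentiableAt 𝓘(ℝ, ℝ) (𝓡 4).tangent
      (fun t ↦ (TotalSpace.mk' E4 (c₀ t) (Tf t) : TangentBundle (𝓡 4) M)) t := fun t ↦
    ((hT.comp hline0) t).mdifferentiableAt hTne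
  have hDtT0 : ∀ t ∈ O, covariantDerivAlong cov c₀ Tf t = 0 := fun t ht ↦ by
    show covariantDerivAlong cov c₀ (fun t ↦ velocity (𝓡 4) c₀ t) t = 0
    rw [covariantDerivAlong_velocity_congr (cov := cov) (hc₀ t ht)]
    exact hgeo.2 t (hOD ht)
  have hderiv : ∀ t ∈ O, HasDerivAt (fun t ↦ g.val (c₀ t) (Af t) (Tf t)) (hacc (t, 0)) t := by
    intro t ht
    have h := g.toPseudoRiemannianMetric.hasDerivAt_val_apply_along hLC.2 (hAfd t) (hTfd t)
    rw [hDtT0 t ht, map_zero, add_zero] at h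
    exact h
  have hFTC : ∫ t in (0 : ℝ)..L₀, hacc (t, 0) =
      g.val (c₀ L₀) (Af L₀) (Tf L₀) - g.val (c₀ 0) (Af 0) (Tf 0) := by
    refine intervalIntegral.integral_eq_sub_of_hasDerivAt (fun t ht ↦ hderiv t (hOsub ?_)) ?_
    · rwa [uIcc_of_le hL₀.le] at ht
    · exact (haccs.continuous.comp (continuous_id.prodMk continuous_const)).intervalIntegrable _ _
  -- the last transverse curve is constant: `A(L₀, 0) = 0`
  have hAL : Af L₀ = 0 := by
    show covariantDerivAlong cov (x L₀) (fun s' ↦ velocity (𝓡 4) (x L₀) s') 0 = 0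
    have hxLc : x L₀ = fun _ ↦ γ L₀ := funext fun σ ↦ hxL σ
    rw [hxLc]
    have hv : (fun s' ↦ velocity (𝓡 4) (fun _ : ℝ ↦ γ L₀) s') =
        fun _ ↦ (0 : TangentSpace (𝓡 4) (γ L₀)) := by
      funext s'
      show mfderiv 𝓘(ℝ, ℝ) (𝓡 4) (fun _ : ℝ ↦ γ L₀) s' 1 = 0
      rw [mfderiv_const]
      rfl
    rw [hv]
    exact covariantDerivAlong_zero_field cov _ 0
  have hT00 : Tf 0 = ν y₀ := by
    show velocity (𝓡 4) c₀ 0 = ν y₀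
    rw [hT0 0 h0O, hv0]
  have hx00 : x 0 0 = f y₀ := (hOp 0 h0O).1.trans hγ0
  -- the first transverse curve `x(0, ·) = f ∘ ζ` and the endmanifold term
  have hx0f : x 0 = fun σ ↦ f (ζ σ) := funext hx0
  have hline1 : ContMDiff 𝓘(ℝ, ℝ) (𝓘(ℝ, ℝ).prod 𝓘(ℝ, ℝ)) ∞ (fun σ : ℝ ↦ (((0 : ℝ), σ) : ℝ × ℝ)) :=
    contMDiff_const.prodMk contMDiff_id
  have hSσ : ∀ σ, MDifferentiableAt 𝓘(ℝ, ℝ) (𝓡 4).tangent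
      (fun σ ↦ (TotalSpace.mk' E4 (x 0 σ) (velocity (𝓡 4) (x 0) σ) : TangentBundle (𝓡 4) M))
      σ := fun σ ↦ ((hS.comp hline1) σ).mdifferentiableAt hTne
  have hνζ : ∀ σ, MDifferentiableAt 𝓘(ℝ, ℝ) (𝓡 4).tangent
      (fun σ ↦ (TotalSpace.mk' E4 (x 0 σ) (ν (ζ σ)) : TangentBundle (𝓡 4) M)) σ := by
    intro σ
    have h1 : (fun σ ↦ (TotalSpace.mk' E4 (x 0 σ) (ν (ζ σ)) : TangentBundle (𝓡 4) M)) =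
        fun σ ↦ (TotalSpace.mk' E4 (f (ζ σ)) (ν (ζ σ)) : TangentBundle (𝓡 4) M) := by
      funext σ
      rw [hx0 σ]
    rw [h1]
    exact ((hν.comp hζs) σ).mdifferentiableAt hTne
  have horth : ∀ σ, g.val (x 0 σ) (velocity (𝓡 4) (x 0) σ) (ν (ζ σ)) = 0 := by
    intro σ
    rw [hx0f]
    show g.val (f (ζ σ)) (velocity (𝓡 4) (f ∘ ζ) σ) (ν (ζ σ)) = 0
    rw [velocity_comp ((hf.contMDiff_self (ζ σ)).mdifferentiableAt hTne)
      ((hζs σ).mdifferentiableAt hTne), g.symm]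
    exact hfun.1.1 (ζ σ) (velocity (𝓡 3) ζ σ)
  have hprod0 := g.toPseudoRiemannianMetric.hasDerivAt_val_apply_along hLC.2 (hSσ 0) (hνζ 0)
  have hzero : g.val (x 0 0) (covariantDerivAlong cov (x 0) (fun σ ↦ velocity (𝓡 4) (x 0) σ) 0)
      (ν (ζ 0)) + g.val (x 0 0) (velocity (𝓡 4) (x 0) 0)
      (covariantDerivAlong cov (x 0) (fun σ ↦ ν (ζ σ)) 0) = 0 := by
    have h2 : HasDerivAt (fun σ ↦ g.val (x 0 σ) (velocity (𝓡 4) (x 0) σ) (ν (ζ σ))) 0 0 := by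
      have h3 : (fun σ ↦ g.val (x 0 σ) (velocity (𝓡 4) (x 0) σ) (ν (ζ σ))) = fun _ ↦ 0 :=
        funext horth
      rw [h3]
      exact hasDerivAt_const 0 0
    exact hprod0.unique h2
  have hDνζ : covariantDerivAlong cov (x 0) (fun σ ↦ ν (ζ σ)) 0 = g.normalDerivAlong f ν y₀ w₀ := by
    rw [hx0f, covariantDerivAlong_comp_eq_normalDerivAlong g.toPseudoRiemannianMetric
      ((hν (ζ 0)).mdifferentiableAt hTne) ((hζs 0).mdifferentiableAt hTne), hζv, hζ0]
  have hS00 : velocity (𝓡 4) (x 0) 0 = mfderiv (𝓡 3) (𝓡 4) f y₀ w₀ := (hS0 0 h0O).trans hV0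
  have hK : g.secondFundamentalForm (𝓡 3) f ν y₀ w₀ w₀ =
      g.val (f y₀) (g.normalDerivAlong f ν y₀ w₀) (mfderiv (𝓡 3) (𝓡 4) f y₀ w₀) :=
    secondFundamentalForm_apply_holds (g := g.toPseudoRiemannianMetric) (I' := 𝓡 3) (y := y₀)
      BoundarylessManifold.isInteriorPoint ((hν y₀).mdifferentiableAt hTne) w₀ w₀
  have hA00 : g.val (c₀ 0) (Af 0) (Tf 0) = -g.secondFundamentalForm (𝓡 3) f ν y₀ w₀ w₀ := by
    rw [hT00, hK]
    show g.val (x 0 0) (covariantDerivAlong cov (x 0) (fun s' ↦ velocity (𝓡 4) (x 0) s') 0)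
      (ν y₀) = _
    rw [hζ0] at hzero
    rw [hDνζ, hS00] at hzero
    have h4 : g.val (x 0 0) (mfderiv (𝓡 3) (𝓡 4) f y₀ w₀) (g.normalDerivAlong f ν y₀ w₀) =
        g.val (f y₀) (g.normalDerivAlong f ν y₀ w₀) (mfderiv (𝓡 3) (𝓡 4) f y₀ w₀) := by
      rw [hx00, g.symm]
    linarith
  /- 11. Conclusion. -/
  have hi1 : IntervalIntegrable (fun t ↦ hacc (t, 0)) volume 0 L₀ :=
    (haccs.continuous.comp (continuous_id.prodMk continuous_const)).intervalIntegrable _ _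
  have hi2 : IntervalIntegrable (fun t ↦ hcurv (t, 0) + hvel (t, 0)) volume 0 L₀ :=
    ((hcurvc.add hvels.continuous).comp (continuous_id.prodMk continuous_const)).intervalIntegrable
      _ _
  have hsplit : ∫ t in (0 : ℝ)..L₀, hh (t, 0) =
      (∫ t in (0 : ℝ)..L₀, hacc (t, 0)) + ∫ t in (0 : ℝ)..L₀, (hcurv (t, 0) + hvel (t, 0)) := by
    rw [← intervalIntegral.integral_add hi1 hi2]
    refine intervalIntegral.integral_congr fun t _ ↦ ?_
    simp only [hhh]
    ring
  -- the integrands along `σ = 0` are `ρ` and `κ`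
  have hρ' : ∀ t ∈ Icc 0 L₀, ρ t = hcurv (t, 0) := by
    intro t ht
    have hO := hOsub ht
    have e1 : ρ t = g.val (γ t) (cov.curvature (γ t) (V t) (velocity (𝓡 4) γ t) (V t))
        (velocity (𝓡 4) γ t) := hρ t ht
    rw [e1]
    show _ = g.val (x t 0) (cov.curvature (x t 0) (velocity (𝓡 4) (x t) 0)
      (velocity (𝓡 4) (fun t' ↦ x t' 0) t) (velocity (𝓡 4) (x t) 0))
      (velocity (𝓡 4) (fun t' ↦ x t' 0) t)
    rw [hS0 t hO, hT0 t hO]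
    rw [(hOp t hO).1]
  have hκ' : ∀ t ∈ Icc 0 L₀, κ t = hvel (t, 0) := by
    intro t ht
    have hO := hOsub ht
    have e2 : κ t = g.val (γ t) (covariantDerivAlong cov γ V t) (covariantDerivAlong cov γ V t) :=
      hκ t ht
    rw [e2]
    show _ = g.val (x t 0)
      (covariantDerivAlong cov (fun t' ↦ x t' 0) (fun t' ↦ velocity (𝓡 4) (x t') 0) t)
      (covariantDerivAlong cov (fun t' ↦ x t' 0) (fun t' ↦ velocity (𝓡 4) (x t') 0) t)
    rw [hDtS0 t hO]
    rw [(hOp t hO).1]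
  have hid : ∫ t in (0 : ℝ)..L₀, (hcurv (t, 0) + hvel (t, 0)) =
      ∫ t in (0 : ℝ)..L₀, (ρ t + κ t) := by
    refine intervalIntegral.integral_congr fun t ht ↦ ?_
    rw [uIcc_of_le hL₀.le] at ht
    show hcurv (t, 0) + hvel (t, 0) = ρ t + κ t
    rw [hρ' t ht, hκ' t ht]
  rw [hsplit, hFTC, hAL, map_zero, zero_apply, zero_sub, hA00, neg_neg, hid] at hint
  refine ⟨?_, ?_, hint⟩
  · have h1 : ContinuousOn (fun t ↦ hcurv (t, 0)) (Icc 0 L₀) :=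
      (hcurvc.comp (continuous_id.prodMk continuous_const)).continuousOn
    exact h1.congr fun t ht ↦ hρ' t ht
  · have h1 : ContinuousOn (fun t ↦ hvel (t, 0)) (Icc 0 L₀) :=
      (hvels.continuous.comp (continuous_id.prodMk continuous_const)).continuousOn
    exact h1.congr fun t ht ↦ hκ' t ht

/-- Functions with vanishing derivative on an open interval are constant there (mean value
theorem, `exists_hasDerivAt_eq_slope`). [folklore] -/
theorem eq_of_hasDerivAt_zero_Ioo {φ : ℝ → ℝ} {p q : ℝ} (h : ∀ t ∈ Ioo p q, HasDerivAt φ 0 t)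
    {s t : ℝ} (hs : s ∈ Ioo p q) (ht : t ∈ Ioo p q) : φ s = φ t := by
  wlog hst : s < t generalizing s t
  · rcases eq_or_lt_of_le (not_lt.1 hst) with h' | h'
    · rw [h']
    · exact (this ht hs h').symm
  have hsub : Icc s t ⊆ Ioo p q := fun x hx ↦ ⟨hs.1.trans_le hx.1, hx.2.trans_lt ht.2⟩
  have hc : ContinuousOn φ (Icc s t) := fun x hx ↦ (h x (hsub hx)).continuousAt.continuousWithinAt
  obtain ⟨c, -, hc'⟩ := exists_hasDerivAt_eq_slope φ (fun _ ↦ (0 : ℝ)) hst hc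
    (fun x hx ↦ h x (hsub (Ioo_subset_Icc_self hx)))
  have h0 : (φ t - φ s) / (t - s) = 0 := hc'.symm
  rw [div_eq_zero_iff, sub_eq_zero, sub_eq_zero] at h0
  rcases h0 with h0 | h0
  · exact h0.symm
  · exact absurd h0 hst.ne'

set_option maxHeartbeats 800000 in
/-- **The second-variation half of O'Neill's proof of Hawking's theorem 14.55A** (O'Neill 1983,
Ch. 10, Prop. 37, Myers form, with the endmanifold second variation Cor. 26–Thm. 28 and
Ch. 14, Thm. 55A; Wald 1984, Prop. 9.3.4): in a four-dimensional spacetime satisfying the timelike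
convergence condition `Ric(v, v) ≥ 0`, let `f : N → M` be a smooth spacelike immersion of a
`3`-manifold with smooth future unit normal field `ν`, and let the normal geodesic segment
`γ(t) = exp_{f y₀}(t ν(y₀))`, `t ∈ [0, L₀]`, `L₀ > 0`, be LENGTH-MAXIMISING among the future
causal curves from `f(N)` to its endpoint (every such curve has length `≤ L₀`). If the mean
curvature satisfies `H(y₀) ≤ -C`, `C > 0`, then `L₀ ≤ 3/C`. Proof (O'Neill, Prop. 10.37): for an
`f^*g`-orthonormal basis `wᵢ` of `T_{y₀}N`, parallel fields `Eᵢ` along `γ` with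
`Eᵢ(0) = df(wᵢ)` (`exists_parallel_frame_smooth`; orthonormal and `⊥ γ'` throughout) and
`Vᵢ = (1 - t/L₀)Eᵢ`, maximality gives `0 ≤ K(wᵢ, wᵢ) + ∫₀ᴸ⁰ (g(R(Vᵢ,γ')Vᵢ,γ') + |Vᵢ'|²) dt` for
each `i` (`secondVariation_nonneg_of_maximal`); summing,
`∑ K(wᵢ,wᵢ) = H(y₀) ≤ -C`, `∑ g(R(Eᵢ,γ')Eᵢ,γ') = -Ric(γ',γ') ≤ 0`
(`ricci_eq_sum_of_orthonormal_timelike`, timelike convergence) and `∑ |Vᵢ'|² = 3/L₀²`, so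
`0 ≤ -C + 3/L₀`. [cite: ONeillSemiRiemannian1983, Ch. 10, Prop. 37 and Ch. 14, Thm. 55A]
[cite: Wald1984GR, Prop. 9.3.4, Thm. 9.5.1] -/
theorem length_le_of_maximal_normalGeodesic (𝓢 : Spacetime.{u} 4)
    [𝓢.metric.HasLeviCivita] (htc : 𝓢.metric.SatisfiesTimelikeConvergence)
    (N : Type u) [TopologicalSpace N] [ChartedSpace E3 N] [IsManifold (𝓡 3) ∞ N]
    (f : N → 𝓢.carrier)
    (hpb : PseudoRiemannianMetric.contMDiff_pullbackBilin (𝓡 4) 𝓢.carrier (𝓡 3) N ∞)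
    (hf : 𝓢.metric.IsSpacelikeImmersion (𝓡 3) f) (ν : NormalField (𝓡 4) f)
    (hν : ContMDiff (𝓡 3) (𝓡 4).tangent ∞
      (fun y ↦ (TotalSpace.mk' E4 (f y) (ν y) : TangentBundle (𝓡 4) 𝓢.carrier)))
    (hfun : 𝓢.metric.IsFutureUnitNormal (𝓡 3) 𝓢.timeOrientation f ν)
    (y₀ : N) (L₀ : ℝ) (hL₀ : 0 < L₀)
    (hdom : Icc 0 L₀ ⊆ maximalGeodesicDomain 𝓢.metric.leviCivita (f y₀) (ν y₀))
    (hmax : ∀ (y' : N) (γ : ℝ → 𝓢.carrier) (a b : ℝ), a < b →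
      𝓢.metric.IsFutureCausalCurveOn 𝓢.timeOrientation γ (Icc a b) → γ a = f y' →
      γ b = expMap 𝓢.metric.leviCivita (f y₀) (L₀ • ν y₀) →
      𝓢.metric.arcLength γ a b ≤ ENNReal.ofReal L₀)
    (C : ℝ) (hC : 0 < C) (hH : 𝓢.metric.meanCurvature f hpb hf ν y₀ ≤ -C) : L₀ ≤ 3 / C := by
  classical
  /- 0. Notation and regularity. -/
  let M := 𝓢.carrier
  let g := 𝓢.metric
  let τ := 𝓢.timeOrientation
  let cov := 𝓢.metric.leviCivita
  let γ : ℝ → M := fun t ↦ expMap cov (f y₀) (t • ν y₀)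
  have hk1 : (((1 : ℕ∞) : ℕ∞ω)) + 1 ≤ ((⊤ : ℕ∞) : ℕ∞ω) := by exact_mod_cast le_top
  have hkT : (((⊤ : ℕ∞) : ℕ∞ω)) + 1 ≤ ((⊤ : ℕ∞) : ℕ∞ω) := by exact_mod_cast le_top
  have hreg₁ : cov.IsLocallyContMDiff 1 := 𝓢.metric.isLocallyContMDiff_leviCivita_holds 1 hk1
  have hreg : cov.IsLocallyContMDiff ∞ := 𝓢.metric.isLocallyContMDiff_leviCivita_holds ⊤ hkT
  haveI : CovariantDerivative.ContMDiffCovariantDerivative cov 1 := ⟨hreg₁ univ isOpen_univ⟩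
  haveI : CovariantDerivative.ContMDiffCovariantDerivative cov (⊤ : ℕ∞) :=
    ⟨hreg univ isOpen_univ⟩
  have hn2 : (2 : ℕ∞ω) ≤ ((⊤ : ℕ∞) : ℕ∞ω) := WithTop.coe_le_coe.mpr le_top
  have hTne : ((⊤ : ℕ∞) : ℕ∞ω) ≠ 0 := by simp
  have hLC : g.IsLeviCivita cov := isLeviCivita_leviCivita_holds (g := g.toPseudoRiemannianMetric)
  /- 1. The normal geodesic and its domain. -/
  obtain ⟨hmaxg, h0D, -, -⟩ := maximalGeodesic_spec' (cov := cov) (f y₀) (ν y₀)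
  let D := maximalGeodesicDomain cov (f y₀) (ν y₀)
  have hDo : IsOpen D := hmaxg.isOpen
  have hgeo : IsGeodesicOn cov γ D := isGeodesicOn_expMap_smul (cov := cov) (f y₀) (ν y₀)
  have hv0 : velocity (𝓡 4) γ 0 = ν y₀ := velocity_expMap_smul_zero (cov := cov) (f y₀) (ν y₀)
  have hγ0 : γ 0 = f y₀ := by
    show expMap cov (f y₀) ((0 : ℝ) • ν y₀) = f y₀
    rw [zero_smul]
    exact expMap_zero (cov := cov) (f y₀)
  have hνν : g.val (f y₀) (ν y₀) (ν y₀) = -1 := hfun.1.2 y₀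
  have hunit : ∀ t ∈ D, g.val (γ t) (velocity (𝓡 4) γ t) (velocity (𝓡 4) γ t) = -1 := by
    intro t ht
    have h := g.toPseudoRiemannianMetric.val_velocity_eq_of_isGeodesicOn_holds hDo hmaxg.2.1
      hgeo ht h0D
    rw [hv0, hγ0] at h
    exact h.trans hνν
  obtain ⟨δ, hδ, hδD⟩ := exists_Ioo_subset_of_Icc_subset hL₀.le hDo hdom
  let d : ℝ := δ / 4
  have hd : d = δ / 4 := rfl
  have hdpos : 0 < d := by positivity
  let J : Set ℝ := Ioo (-(2 * d)) (L₀ + 2 * d)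
  have hJD : J ⊆ D := fun t ht ↦ hδD ⟨by linarith [ht.1, hd], by linarith [ht.2, hd]⟩
  have h0J : (0 : ℝ) ∈ J := ⟨by linarith, by linarith⟩
  have hIccJ : Icc 0 L₀ ⊆ J := fun t ht ↦ ⟨by linarith [ht.1], by linarith [ht.2]⟩
  have hIooD : Ioo (-d) (L₀ + d) ⊆ D := fun t ht ↦ hJD ⟨by linarith [ht.1], by linarith [ht.2]⟩
  /- 2. A globally smooth reparametrisation `γt = γ ∘ θ` agreeing with `γ` on `J`. -/
  have hγsm : ∀ t ∈ D, ContMDiffAt 𝓘(ℝ, ℝ) (𝓡 4) ∞ γ t := fun t ht ↦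
    (contMDiffAt_normalExp (cov := cov) (k := (⊤ : ℕ∞)) (ι := f) (ν := ν) le_top hν ht).comp t
      (contMDiffAt_const.prodMk contMDiffAt_id)
  obtain ⟨θ, hθs, hθm, hθe⟩ := exists_smooth_clamp_Icc (a := -(2 * d)) (b := L₀ + 2 * d)
    (by linarith) hdpos
  have hθD : ∀ t, θ t ∈ D := fun t ↦ by
    have h := hθm t
    exact hδD ⟨by linarith [h.1, hd], by linarith [h.2, hd]⟩
  have hθJ : ∀ t ∈ J, θ t = t := fun t ht ↦
    hθe.self_of_nhdsSet t (Ioo_subset_Icc_self ht)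
  let γt : ℝ → M := fun t ↦ γ (θ t)
  have hγts : ContMDiff 𝓘(ℝ, ℝ) (𝓡 4) ∞ γt := fun t ↦
    (hγsm (θ t) (hθD t)).comp t (hθs.contMDiff t)
  have hbJ : ∀ t ∈ J, γt t = γ t := fun t ht ↦ by
    show γ (θ t) = γ t
    rw [hθJ t ht]
  have hγtJ : ∀ t ∈ J, γt =ᶠ[𝓝 t] γ := fun t ht ↦
    Filter.eventually_of_mem (isOpen_Ioo.mem_nhds ht) fun t' ht' ↦ hbJ t' ht'
  have hγt0 : γt 0 = f y₀ := (hbJ 0 h0J).trans hγ0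
  have hvelJ : ∀ t ∈ J, velocity (𝓡 4) γt t = velocity (𝓡 4) γ t := fun t ht ↦
    velocity_congr_of_eventuallyEq (I := 𝓡 4) (hγtJ t ht)
  have hTlift : ∀ t ∈ J, MDifferentiableAt 𝓘(ℝ, ℝ) (𝓡 4).tangent (tangentLift (𝓡 4) γt) t :=
    fun t ht ↦ (hgeo.1 t (hJD ht)).congr_of_eventuallyEq
      (tangentLift_eventuallyEq_of_eventuallyEq (hγtJ t ht))
  have hDT : ∀ t ∈ J, covariantDerivAlong cov γt (fun t ↦ velocity (𝓡 4) γt t) t = 0 :=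
    fun t ht ↦ by
      rw [covariantDerivAlong_velocity_congr (cov := cov) (hγtJ t ht)]
      exact hgeo.2 t (hJD ht)
  /- 3. An orthonormal frame at `y₀`. -/
  obtain ⟨e, he, hene⟩ := (g.inducedMetric f hpb hf).exists_isOrthoᵢ_basis y₀
  have hfin : Module.finrank ℝ (TangentSpace (𝓡 3) y₀) = 3 := finrank_euclideanSpace_fin
  have hcardι : Fintype.card (Fin (Module.finrank ℝ (TangentSpace (𝓡 3) y₀))) = 3 := by
    rw [Fintype.card_fin, hfin]
  have hval : ∀ v v' : TangentSpace (𝓡 3) y₀, (g.inducedMetric f hpb hf).val y₀ v v' =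
      g.val (f y₀) (mfderiv (𝓡 3) (𝓡 4) f y₀ v) (mfderiv (𝓡 3) (𝓡 4) f y₀ v') :=
    fun v v' ↦ rfl
  have hepos : ∀ i, 0 < (g.inducedMetric f hpb hf).val y₀ (e i) (e i) := fun i ↦
    hf.inducedBilin_pos y₀ (e.ne_zero i)
  let r : Fin (Module.finrank ℝ (TangentSpace (𝓡 3) y₀)) → ℝ :=
    fun i ↦ (Real.sqrt ((g.inducedMetric f hpb hf).val y₀ (e i) (e i)))⁻¹
  have hr : r = fun i ↦ (Real.sqrt ((g.inducedMetric f hpb hf).val y₀ (e i) (e i)))⁻¹ := rfl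
  have hrr : ∀ i, r i * r i = ((g.inducedMetric f hpb hf).val y₀ (e i) (e i))⁻¹ := fun i ↦ by
    rw [hr, ← mul_inv, Real.mul_self_sqrt (hepos i).le]
  let w : Fin (Module.finrank ℝ (TangentSpace (𝓡 3) y₀)) → TangentSpace (𝓡 3) y₀ :=
    fun i ↦ r i • e i
  have hw : w = fun i ↦ r i • e i := rfl
  have hgTw : ∀ i j, (g.inducedMetric f hpb hf).val y₀ (w i) (w j) = if i = j then 1 else 0 := by
    intro i j
    simp only [hw, map_smul, smul_eq_mul, FunLike.coe_smul, Pi.smul_apply]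
    by_cases hij : i = j
    · subst hij
      rw [if_pos rfl, ← mul_assoc, hrr, inv_mul_cancel₀ (hene i)]
    · rw [if_neg hij]
      have h : (g.inducedMetric f hpb hf).val y₀ (e i) (e j) = 0 :=
        LinearMap.isOrthoᵢ_def.1 he i j hij
      rw [h, mul_zero, mul_zero]
  let u : Fin (Module.finrank ℝ (TangentSpace (𝓡 3) y₀)) → TangentSpace (𝓡 4) (f y₀) :=
    fun i ↦ mfderiv (𝓡 3) (𝓡 4) f y₀ (w i)
  have hu : u = fun i ↦ mfderiv (𝓡 3) (𝓡 4) f y₀ (w i) := rfl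
  have huu : ∀ i j, g.val (f y₀) (u i) (u j) = if i = j then 1 else 0 := fun i j ↦ by
    rw [hu, ← hval]
    exact hgTw i j
  have huν : ∀ i, g.val (f y₀) (u i) (ν y₀) = 0 := fun i ↦ by
    rw [g.symm]
    exact hfun.1.1 y₀ (w i)
  -- `∑ K(wᵢ, wᵢ) = H(y₀)`
  have hKsum : ∑ i, g.secondFundamentalForm (𝓡 3) f ν y₀ (w i) (w i) =
      g.meanCurvature f hpb hf ν y₀ := by
    rw [meanCurvature_eq_sum_of_isOrthoᵢ g.toPseudoRiemannianMetric hpb hf ν y₀ e he hene]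
    refine Finset.sum_congr rfl fun i _ ↦ ?_
    simp only [hw, map_smul, LinearMap.smul_apply, smul_eq_mul]
    rw [← mul_assoc, hrr i, div_eq_inv_mul]
  /- 4. The parallel frame along `γt` on `J`. -/
  obtain ⟨e', he'0, he'par, he'sm, he'val⟩ := exists_parallel_frame_smooth
    g.toPseudoRiemannianMetric hLC.2 hreg hγts (a := -(2 * d)) (b := L₀ + 2 * d) (t₀ := 0) h0J
    (fun i ↦ (u i : TangentSpace (𝓡 4) (γt 0)))
  -- the frame retyped along `γ` (same vectors; `γt = γ` on `J`)
  let E' : Fin (Module.finrank ℝ (TangentSpace (𝓡 3) y₀)) → Π t : ℝ, TangentSpace (𝓡 4) (γ t) :=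
    fun i t ↦ e' i t
  have he'on : ∀ t ∈ J, ∀ i j, g.val (γ t) (E' i t) (E' j t) = if i = j then 1 else 0 := by
    intro t ht i j
    have h := he'val t ht i j
    rw [hbJ t ht, hγt0] at h
    exact h.trans (huu i j)
  -- the frame stays orthogonal to `γ'`
  have hφ' : ∀ i, ∀ t ∈ J,
      HasDerivAt (fun t ↦ g.val (γt t) (e' i t) (velocity (𝓡 4) γt t)) 0 t := by
    intro i t ht
    have h := g.toPseudoRiemannianMetric.hasDerivAt_val_apply_along hLC.2
      ((he'sm i t ht).mdifferentiableAt hTne) (hTlift t ht)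
    rw [(he'par i t ht).2, hDT t ht, map_zero, zero_apply, map_zero, zero_add] at h
    exact h
  have horth : ∀ i, ∀ t ∈ J, g.val (γ t) (E' i t) (velocity (𝓡 4) γ t) = 0 := by
    intro i t ht
    have h1 := eq_of_hasDerivAt_zero_Ioo (hφ' i) ht h0J
    rw [he'0, hvelJ 0 h0J, hv0, hγt0, huν, hvelJ t ht, hbJ t ht] at h1
    exact h1
  /- 5. The variation fields `Vᵢ = (1 - t/L₀) Eᵢ`. -/
  let φ : ℝ → ℝ := fun t ↦ 1 - t / L₀
  have hφdef : φ = fun t ↦ 1 - t / L₀ := rfl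
  have hφd : ∀ t, HasDerivAt φ (-(1 / L₀)) t := fun t ↦ by
    have := ((hasDerivAt_id t).div_const L₀).const_sub 1
    simpa using this
  have hφs : ContDiff ℝ ∞ φ := contDiff_const.sub (contDiff_id.div_const _)
  let Vf : Fin (Module.finrank ℝ (TangentSpace (𝓡 3) y₀)) → Π t : ℝ, TangentSpace (𝓡 4) (γ t) :=
    fun i t ↦ φ t • E' i t
  have hVf : Vf = fun i t ↦ φ t • E' i t := rfl
  have hliftJ : ∀ i, ∀ t ∈ J,
      (fun t' ↦ (TotalSpace.mk' E4 (γ t') (Vf i t') : TangentBundle (𝓡 4) M)) =ᶠ[𝓝 t]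
        fun t' ↦ (TotalSpace.mk' E4 (γt t') (φ t' • e' i t') : TangentBundle (𝓡 4) M) := by
    intro i t ht
    filter_upwards [isOpen_Ioo.mem_nhds ht] with t' ht'
    show TotalSpace.mk' E4 (γ t') (φ t' • E' i t') = TotalSpace.mk' E4 (γt t') (φ t' • e' i t')
    rw [hbJ t' ht']
  have hVsmJ : ∀ i, ∀ t ∈ J, ContMDiffAt 𝓘(ℝ, ℝ) (𝓡 4).tangent ∞
      (fun t' ↦ (TotalSpace.mk' E4 (γ t') (Vf i t') : TangentBundle (𝓡 4) M)) t := by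
    intro i t ht
    have h1 := contMDiffAt_totalSpaceMk_smul (I := 𝓡 4) (c := γt) (V := e' i) (he'sm i t ht) (φ t)
    have h2 : ContMDiffAt 𝓘(ℝ, ℝ) (𝓘(ℝ, ℝ).prod 𝓘(ℝ, ℝ)) ∞ (fun t' : ℝ ↦ ((φ t', t') : ℝ × ℝ)) t :=
      (hφs.contMDiff t).prodMk contMDiffAt_id
    have h3 : ContMDiffAt 𝓘(ℝ, ℝ) (𝓡 4).tangent ∞
        (fun t' ↦ (TotalSpace.mk' E4 (γt t') (φ t' • e' i t') : TangentBundle (𝓡 4) M)) t :=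
      h1.comp_of_eq h2 rfl
    exact h3.congr_of_eventuallyEq (hliftJ i t ht)
  have hVsm : ∀ i, ∀ t ∈ Ioo (-d) (L₀ + d), ContMDiffAt 𝓘(ℝ, ℝ) (𝓡 4).tangent ∞
      (fun t' ↦ (TotalSpace.mk' E4 (γ t') (Vf i t') : TangentBundle (𝓡 4) M)) t :=
    fun i t ht ↦ hVsmJ i t ⟨by linarith [ht.1], by linarith [ht.2]⟩
  have hVL : ∀ i, Vf i L₀ = 0 := fun i ↦ by
    have h : φ L₀ = 0 := by simp only [hφdef, div_self hL₀.ne', sub_self]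
    show φ L₀ • E' i L₀ = 0
    rw [h, zero_smul]
  have hV0 : ∀ i, Vf i 0 = mfderiv (𝓡 3) (𝓡 4) f y₀ (w i) := fun i ↦ by
    have h : φ 0 = 1 := by simp only [hφdef, zero_div, sub_zero]
    show φ 0 • E' i 0 = _
    rw [h, one_smul]
    exact he'0 i
  have hDV : ∀ i, ∀ t ∈ J, covariantDerivAlong cov γ (Vf i) t = (-(1 / L₀)) • E' i t := by
    intro i t ht
    rw [covariantDerivAlong_congr_of_eventuallyEq cov (hliftJ i t ht),
      covariantDerivAlong_smul_holds (cov := cov) (hφd t).differentiableAt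
        ((he'sm i t ht).mdifferentiableAt hTne), (he'par i t ht).2, smul_zero, add_zero,
      (hφd t).deriv]
    rfl
  have hVperp : ∀ i, ∀ t ∈ Icc 0 L₀,
      g.val (γ t) (covariantDerivAlong cov γ (Vf i) t) (velocity (𝓡 4) γ t) = 0 := by
    intro i t ht
    have htJ := hIccJ ht
    rw [hDV i t htJ, (g.val (γ t)).map_smul, smul_apply, horth i t htJ, smul_zero]
  /- 6. The second variation in the direction of each `Vᵢ` is nonnegative. -/
  have hV := fun i ↦ secondVariation_nonneg_of_maximal 𝓢 hf hν hfun (y₀ := y₀) (L₀ := L₀)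
    (a := -d) (b := L₀ + d) (by linarith) hL₀ (by linarith) hIooD hmax (V := Vf i) (hVsm i)
    (hVL i) (hV0 i) (hVperp i)
    (ρ := fun t ↦ g.val (γ t) (cov.curvature (γ t) (Vf i t) (velocity (𝓡 4) γ t) (Vf i t))
      (velocity (𝓡 4) γ t))
    (κ := fun t ↦
      g.val (γ t) (covariantDerivAlong cov γ (Vf i) t) (covariantDerivAlong cov γ (Vf i) t))
    (fun _ _ ↦ rfl) (fun _ _ ↦ rfl)
  /- 7. The integrands. -/
  let F : Fin (Module.finrank ℝ (TangentSpace (𝓡 3) y₀)) → ℝ → ℝ := fun i t ↦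
    g.val (γ t) (cov.curvature (γ t) (Vf i t) (velocity (𝓡 4) γ t) (Vf i t)) (velocity (𝓡 4) γ t) +
      g.val (γ t) (covariantDerivAlong cov γ (Vf i) t) (covariantDerivAlong cov γ (Vf i) t)
  have hF : F = fun i t ↦
    g.val (γ t) (cov.curvature (γ t) (Vf i t) (velocity (𝓡 4) γ t) (Vf i t)) (velocity (𝓡 4) γ t) +
      g.val (γ t) (covariantDerivAlong cov γ (Vf i) t) (covariantDerivAlong cov γ (Vf i) t) := rfl
  have hFc : ∀ i, ContinuousOn (F i) (Icc 0 L₀) := fun i ↦ (hV i).1.add (hV i).2.1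
  have hFi : ∀ i, IntervalIntegrable (F i) volume 0 L₀ := fun i ↦
    (hFc i).intervalIntegrable_of_Icc hL₀.le
  have hineq : ∀ i, 0 ≤ g.secondFundamentalForm (𝓡 3) f ν y₀ (w i) (w i) +
      ∫ t in (0 : ℝ)..L₀, F i t := fun i ↦ (hV i).2.2
  -- pointwise: `∑ᵢ Fᵢ(t) = φ² ∑ᵢ g(R(Eᵢ,γ')Eᵢ,γ') + 3/L₀² ≤ 3/L₀²`
  have hRsum : ∀ t ∈ J, ∑ i, g.val (γ t) (cov.curvature (γ t) (E' i t) (velocity (𝓡 4) γ t)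
      (E' i t)) (velocity (𝓡 4) γ t) =
        -g.ricci (γ t) (velocity (𝓡 4) γ t) (velocity (𝓡 4) γ t) := by
    intro t ht
    have hE4 : Module.finrank ℝ E4 = 4 := finrank_euclideanSpace_fin
    have hcard : Fintype.card (Fin (Module.finrank ℝ (TangentSpace (𝓡 3) y₀))) + 1 =
        Module.finrank ℝ E4 := by rw [hcardι, hE4]
    have hric := ricci_eq_sum_of_orthonormal_timelike g.toPseudoRiemannianMetric (γ t)
      (T := velocity (𝓡 4) γ t) (hunit t (hJD ht))
      (e := fun i ↦ E' i t)
      (he'on t ht) (fun i ↦ horth i t ht) hcard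
    change g.ricci (γ t) (velocity (𝓡 4) γ t) (velocity (𝓡 4) γ t) =
      ∑ i, g.val (γ t) (cov.curvature (γ t) (E' i t) (velocity (𝓡 4) γ t) (velocity (𝓡 4) γ t))
        (E' i t) at hric
    rw [hric, ← Finset.sum_neg_distrib]
    refine Finset.sum_congr rfl fun i _ ↦ ?_
    rw [hLC.val_curvature_skew hn2 (γ t)]
  have hFsum : ∀ t ∈ Icc 0 L₀, ∑ i, F i t ≤ 3 / L₀ ^ 2 := by
    intro t ht
    have htJ := hIccJ ht
    have htD := hJD htJ
    have h1 : ∀ i, F i t = φ t ^ 2 * g.val (γ t) (cov.curvature (γ t) (E' i t) (velocity (𝓡 4) γ t)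
        (E' i t)) (velocity (𝓡 4) γ t) + 1 / L₀ ^ 2 := by
      intro i
      show g.val (γ t) (cov.curvature (γ t) (Vf i t) (velocity (𝓡 4) γ t) (Vf i t))
          (velocity (𝓡 4) γ t) +
        g.val (γ t) (covariantDerivAlong cov γ (Vf i) t) (covariantDerivAlong cov γ (Vf i) t) = _
      rw [hDV i t htJ]
      show g.val (γ t) (cov.curvature (γ t) (φ t • E' i t) (velocity (𝓡 4) γ t) (φ t • E' i t))
          (velocity (𝓡 4) γ t) +
        g.val (γ t) ((-(1 / L₀)) • E' i t) ((-(1 / L₀)) • E' i t) = _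
      simp only [ContinuousLinearMap.map_smul, smul_apply, smul_eq_mul]
      rw [he'on t htJ i i, if_pos rfl]
      ring
    have hsum1 : ∑ i, F i t = φ t ^ 2 * ∑ i, g.val (γ t) (cov.curvature (γ t) (E' i t)
        (velocity (𝓡 4) γ t) (E' i t)) (velocity (𝓡 4) γ t) + 3 * (1 / L₀ ^ 2) := by
      rw [Finset.sum_congr rfl fun i _ ↦ h1 i, Finset.sum_add_distrib, Finset.sum_const,
        Finset.card_univ, hcardι, ← Finset.mul_sum, nsmul_eq_mul]
      push_cast
      ring
    rw [hsum1, hRsum t htJ]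
    have hric : 0 ≤ g.ricci (γ t) (velocity (𝓡 4) γ t) (velocity (𝓡 4) γ t) := by
      refine htc (γ t) (velocity (𝓡 4) γ t) ?_
      show g.val (γ t) (velocity (𝓡 4) γ t) (velocity (𝓡 4) γ t) < 0
      rw [hunit t htD]
      norm_num
    have hφ2 : 0 ≤ φ t ^ 2 := sq_nonneg _
    have h3 : (3 : ℝ) * (1 / L₀ ^ 2) = 3 / L₀ ^ 2 := by ring
    have key : φ t ^ 2 * -g.ricci (γ t) (velocity (𝓡 4) γ t) (velocity (𝓡 4) γ t) ≤ 0 :=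
      mul_nonpos_of_nonneg_of_nonpos hφ2 (neg_nonpos.2 hric)
    linarith
  /- 8. Summation. -/
  have hsumint : ∑ i, ∫ t in (0 : ℝ)..L₀, F i t ≤ 3 / L₀ := by
    rw [← intervalIntegral.integral_finsetSum (fun i _ ↦ hFi i)]
    have hmono := intervalIntegral.integral_mono_on hL₀.le
      ((continuousOn_finsetSum _ fun i _ ↦ hFc i).intervalIntegrable_of_Icc
        (μ := volume) hL₀.le)
      (intervalIntegrable_const (c := 3 / L₀ ^ 2)) (fun t ht ↦ hFsum t ht)
    refine hmono.trans_eq ?_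
    rw [intervalIntegral.integral_const, sub_zero, smul_eq_mul]
    field_simp
  have htotal : 0 ≤ ∑ i, (g.secondFundamentalForm (𝓡 3) f ν y₀ (w i) (w i) +
      ∫ t in (0 : ℝ)..L₀, F i t) := Finset.sum_nonneg fun i _ ↦ hineq i
  rw [Finset.sum_add_distrib, hKsum] at htotal
  have hCL : C ≤ 3 / L₀ := by linarith
  rw [le_div_iff₀ hC]
  rw [le_div_iff₀ hL₀] at hCL
  linarith

end Literature.Geometry.Lorentzian

end
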